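import Summits.Ventures.YMGap.Census.InterpolationAlpha
import Summits.Ventures.YMGap.Census.InterpolationAlphaPlus
import Summits.Ventures.YMGap.Census.DecimationIterated
import HarnessLib

/-!
# Venture YMGap, track (b) — NON-TRIVIALITY along Tomboulis's decimation / interpolation, and UNIQUENESS of the
# interpolation parameters `α_Λ(t, r)`, `α⁺_Λ(t, r)` (arXiv:0707.2179 (2.22), Props. III.3 / IV.5, §3.2 after (3.23))

HONEST FRAMING: venture file of the cell `pub-ymgap` (QuantumFields programme), track (b) census.  Exact statements about one
decimation `(ℤ/bLℤ)^d → (ℤ/Lℤ)^d` and the interpolation `c ↦ α c`; finite tori only; nothing about (5.15)/(5.16), Ito–Seiler's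
Problem 2 (`Tomboulis2007.ISProblem2`, untouched), limits, confinement or a mass gap.

Tomboulis's «trivial case where all `c_j` vanish» is the only obstruction to strictness in II.1 / III.1–III.3 / IV.2–IV.5.  This file
shows that non-triviality and positivity SURVIVE the two operations of the scheme and draws the uniqueness half of III.3 / IV.5:
* `stdCoef_le_powCoef_succ` (`(f_c^{k+1})_n ≥ (n+1) c_n`), **`mkFhat_pos_of_pos`** (`F̂_j ≥ c_j > 0`, integer `ζ ≥ 1`, (2.22)),
  **`mkCoeff_pos_of_pos`** (`c^U_j(1, r) > 0` for every real `r`), **`one_lt_mkFhat_zero`** / **`one_lt_mkF0`** (`F̂_0 > 1`, `F₀^U > 1`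
  STRICTLY for `ζ ≥ 2`, i.e. `b ≥ 2`, `d ≥ 3` — `two_le_zeta`), `iterCoeff_pos_of_pos` (along the `r = 1` flow of `DecimationIterated`);
* `plaqFn_scaleCoeff` (`f_{αc} = (1-α) + α f_c`), `plaqFn_scaleCoeff_nonneg` (`α ∈ [0,1]`), `step_class_scaleCoeff_mkCoeff` — after ANY
  choice `α ∈ (0,1]` the next starting point `α · c^U(1,1)` is again admissible, with `f ≥ 0` and a positive coefficient;
* **`tildeZ_strictMonoOn`** / **`tildeZplus_strictMonoOn`** — Props. III.3 / IV.5 in STRICT form on `α ∈ (0, 1]` for `t > 0` (`d ≥ 3`,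
  `b ≥ 2`, even coarse torus, positivity domain, some `c_n > 0`): the bulk factor `F₀^U > 1` carries the strictly increasing exponent
  `h(α,t) |Λ^{(1)}|` (`interpH_strictMonoOn`) while `Z_{Λ^{(1)}}({α c^U})` (`Z⁺`) is non-decreasing (II.1 (i) / IV.2 (i)) and positive;
  hence **`isAlpha_unique`** / **`isAlphaPlus_unique`** — «This value is unique by III.3» (after (3.23)): the tree's defining
  relations `IsAlpha d L b J r c t ·`, `IsAlphaPlus L b J r i j hij c t ·` have AT MOST one solution.
(The printed III.3 asserts strict increase of `ln Z_{Λ^{(m)}}({c̃_j(α)})` itself, i.e. STRICT II.1 (i); the route here uses the bulk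
factor instead and needs `t > 0`, which is the printed range `0 < t_a ≤ t ≤ t_b`.)  Existence in the open interval is
`DecimationStrict.exists_isAlpha` / `exists_isAlphaPlus` (strict potential moving).

References: E. T. Tomboulis, arXiv:0707.2179, §2 (2.22), §3.2 (3.16)–(3.24), Props. III.3, IV.5 [cite: Tomboulis2007Confinement,
§3.2 eqs. (3.21)–(3.24)]; K. R. Ito, E. Seiler, arXiv:0711.4930, §2 (2.4)–(2.6) [cite: ItoSeiler2007Tomboulis, §2 eq. (2.5)].
-/

noncomputable section

open MeasureTheory Finset Real Function
open scoped BigOperators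
open Literature.MathematicalPhysics.QuantumLattice
open Literature.MathematicalPhysics.QuantumFieldTheory
open Literature.MathematicalPhysics.QuantumFieldTheory.Tomboulis2007
open Literature.MathematicalPhysics.QuantumFieldTheory.WilsonRP
open Summit.Ventures.LatticeQCDFlow.Exactness
open Summit.Ventures.LatticeQCDFlow.Scoring

namespace Summit.Ventures.YMGap.Census

variable {d L : ℕ}

/-! ### Non-triviality survives the decimation step: `F̂_j ≥ c_j`, `F̂_0 > 1` -/

section Coefficients

variable {b : ℕ}

/-- `N_{0 n}^{n} = 1`: `χ_0 χ_n` contains `χ_n` once. -/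
theorem cgMult_zero_left (n : ℕ) : cgMult 0 n n = 1 := by
  simp [cgMult]

/-- **The `n`-th coefficient of `f_c^{k+1}` dominates `(n+1) c_n`** (all coefficients `≥ 0`; the term `χ_0 · (n+1) c_n χ_n` of the
product `f_c^k · f_c`). -/
theorem stdCoef_le_powCoef_succ {J : ℕ} {c : ℕ → ℝ} (hc : ∀ n, 1 ≤ n → 0 ≤ c n) (k : ℕ) {n : ℕ} (hn : n ∈ Icc 1 J) :
    ((n : ℝ) + 1) * c n ≤ powCoef J c (k + 1) n := by
  have hnJ : n ≤ J := (Finset.mem_Icc.1 hn).2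
  have hn1 : 1 ≤ n := (Finset.mem_Icc.1 hn).1
  have hterm : ∀ i j, 0 ≤ powCoef J c k i * stdCoef c j * cgMult i j n := fun i j =>
    mul_nonneg (mul_nonneg (powCoef_nonneg hc k i) (stdCoef_nonneg hc j)) (cgMult_nonneg i j n)
  have hstd : stdCoef c n = ((n : ℝ) + 1) * c n := by simp [stdCoef, show n ≠ 0 by omega]
  change ((n : ℝ) + 1) * c n ≤ mulCoef (k * J) J (powCoef J c k) (stdCoef c) n
  unfold mulCoef
  calc ((n : ℝ) + 1) * c n ≤ powCoef J c k 0 * stdCoef c n * cgMult 0 n n := by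
        rw [cgMult_zero_left, mul_one, hstd]
        exact le_mul_of_one_le_left (mul_nonneg (by positivity) (hc n hn1)) (one_le_powCoef_zero hc k)
    _ ≤ ∑ j ∈ Finset.range (J + 1), powCoef J c k 0 * stdCoef c j * cgMult 0 j n :=
        Finset.single_le_sum (f := fun j => powCoef J c k 0 * stdCoef c j * cgMult 0 j n) (fun j _ => hterm 0 j)
          (Finset.mem_range.2 (Nat.lt_succ_of_le hnJ))
    _ ≤ ∑ i ∈ Finset.range (k * J + 1), ∑ j ∈ Finset.range (J + 1), powCoef J c k i * stdCoef c j * cgMult i j n :=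
        Finset.single_le_sum (f := fun i => ∑ j ∈ Finset.range (J + 1), powCoef J c k i * stdCoef c j * cgMult i j n)
          (fun i _ => Finset.sum_nonneg fun j _ => hterm i j) (Finset.mem_range.2 (Nat.succ_pos _))

/-- **`F̂_j ≥ c_j > 0`** for integer `ζ ≥ 1` when `c_j > 0` (`1 ≤ 2j ≤ J`, all `c ≥ 0`): non-triviality survives (2.22). -/
theorem mkFhat_pos_of_pos {J : ℕ} {c : ℕ → ℝ} (hc : ∀ n, 1 ≤ n → 0 ≤ c n) {ζ : ℕ} (hζ : 1 ≤ ζ) {n₀ : ℕ}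
    (hn₀ : n₀ ∈ Icc 1 J) (hpos : 0 < c n₀) : 0 < mkFhat J c ζ n₀ := by
  have hnJ : n₀ ≤ J := (Finset.mem_Icc.1 hn₀).2
  have hle : n₀ ≤ ζ * J := hnJ.trans (Nat.le_mul_of_pos_left J hζ)
  rw [mkFhat_eq, if_pos hle]
  obtain ⟨k, rfl⟩ : ∃ k, ζ = k + 1 := ⟨ζ - 1, by omega⟩
  have h := stdCoef_le_powCoef_succ hc k hn₀
  have hpos' : 0 < ((n₀ : ℝ) + 1) * c n₀ := by positivity
  exact div_pos (hpos'.trans_le h) (by positivity)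

/-- **`c^U_j(1, r) > 0`** when `c_j > 0` (integer `ζ ≥ 1`, any real `r`): the decimated action is again non-trivial. -/
theorem mkCoeff_pos_of_pos {J : ℕ} {c : ℕ → ℝ} (hc : ∀ n, 1 ≤ n → 0 ≤ c n) {ζ : ℕ} (hζ : 1 ≤ ζ) {n₀ : ℕ}
    (hn₀ : n₀ ∈ Icc 1 J) (hpos : 0 < c n₀) (r : ℝ) : 0 < mkCoeff J c ζ b r n₀ := by
  unfold mkCoeff
  exact Real.rpow_pos_of_pos (div_pos (mkFhat_pos_of_pos hc hζ hn₀ hpos) (mkFhat_zero_pos hc ζ)) _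

/-- **`F̂_0 > 1` strictly** for integer `ζ ≥ 2` when some `c_j > 0`: the trivial coefficient of `f_c^ζ = f_c^{ζ-1} · f_c` contains,
besides `(f^{ζ-1})_0 · 1 ≥ 1`, the term `(f^{ζ-1})_{j} (j+1) c_j N_{jj}^0 ≥ ((j+1) c_j)² > 0`.  (For `ζ = 1`, `F̂_0 = 1`.) -/
theorem one_lt_mkFhat_zero {J : ℕ} {c : ℕ → ℝ} (hc : ∀ n, 1 ≤ n → 0 ≤ c n) {ζ : ℕ} (hζ : 2 ≤ ζ) {n₀ : ℕ}
    (hn₀ : n₀ ∈ Icc 1 J) (hpos : 0 < c n₀) : 1 < mkFhat J c ζ 0 := by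
  have hnJ : n₀ ≤ J := (Finset.mem_Icc.1 hn₀).2
  have hn1 : 1 ≤ n₀ := (Finset.mem_Icc.1 hn₀).1
  rw [mkFhat_eq, if_pos (Nat.zero_le _), Nat.cast_zero, zero_add, div_one]
  obtain ⟨k, rfl⟩ : ∃ k, ζ = k + 2 := ⟨ζ - 2, by omega⟩
  change (1 : ℝ) < mulCoef ((k + 1) * J) J (powCoef J c (k + 1)) (stdCoef c) 0
  unfold mulCoef
  set g : ℕ → ℝ := fun i => ∑ j ∈ Finset.range (J + 1), powCoef J c (k + 1) i * stdCoef c j * cgMult i j 0 with hg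
  have hterm : ∀ i j, 0 ≤ powCoef J c (k + 1) i * stdCoef c j * cgMult i j 0 := fun i j =>
    mul_nonneg (mul_nonneg (powCoef_nonneg hc (k + 1) i) (stdCoef_nonneg hc j)) (cgMult_nonneg i j 0)
  have hg0 : 1 ≤ g 0 := by
    calc (1 : ℝ) ≤ powCoef J c (k + 1) 0 * stdCoef c 0 * cgMult 0 0 0 := by
          rw [cgMult_self_zero, mul_one, show stdCoef c 0 = 1 by simp [stdCoef], mul_one]
          exact one_le_powCoef_zero hc (k + 1)
      _ ≤ g 0 := Finset.single_le_sum (f := fun j => powCoef J c (k + 1) 0 * stdCoef c j * cgMult 0 j 0) (fun j _ => hterm 0 j)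
          (Finset.mem_range.2 (Nat.succ_pos J))
  have hgn : 0 < g n₀ := by
    have hstd : stdCoef c n₀ = ((n₀ : ℝ) + 1) * c n₀ := by simp [stdCoef, show n₀ ≠ 0 by omega]
    calc (0 : ℝ) < powCoef J c (k + 1) n₀ * stdCoef c n₀ * cgMult n₀ n₀ 0 := by
          rw [cgMult_self_zero, mul_one, hstd]
          have h1 : 0 < ((n₀ : ℝ) + 1) * c n₀ := by positivity
          exact mul_pos (h1.trans_le (stdCoef_le_powCoef_succ hc k hn₀)) h1
      _ ≤ g n₀ := Finset.single_le_sum (f := fun j => powCoef J c (k + 1) n₀ * stdCoef c j * cgMult n₀ j 0) (fun j _ => hterm n₀ j)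
          (Finset.mem_range.2 (Nat.lt_succ_of_le hnJ))
  have hsub : ({0, n₀} : Finset ℕ) ⊆ Finset.range ((k + 1) * J + 1) := by
    intro i hi
    rcases Finset.mem_insert.1 hi with rfl | hi
    · exact Finset.mem_range.2 (Nat.succ_pos _)
    · rw [Finset.mem_singleton.1 hi]
      exact Finset.mem_range.2 (Nat.lt_succ_of_le (hnJ.trans (Nat.le_mul_of_pos_left J (Nat.succ_pos k))))
  have hne : (0 : ℕ) ≠ n₀ := by omega
  calc (1 : ℝ) < g 0 + g n₀ := by linarith
    _ = ∑ i ∈ ({0, n₀} : Finset ℕ), g i := (Finset.sum_pair hne).symm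
    _ ≤ ∑ i ∈ Finset.range ((k + 1) * J + 1), g i :=
        Finset.sum_le_sum_of_subset_of_nonneg hsub fun i _ _ => Finset.sum_nonneg fun j _ => hterm i j

/-- **`F₀^U = F̂_0^{b²} > 1`** for `ζ ≥ 2`, `b ≥ 1` and a non-trivial action. -/
theorem one_lt_mkF0 [NeZero b] {J : ℕ} {c : ℕ → ℝ} (hc : ∀ n, 1 ≤ n → 0 ≤ c n) {ζ : ℕ} (hζ : 2 ≤ ζ) {n₀ : ℕ}
    (hn₀ : n₀ ∈ Icc 1 J) (hpos : 0 < c n₀) : 1 < mkF0 J c ζ b := by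
  unfold mkF0
  exact one_lt_pow₀ (one_lt_mkFhat_zero hc hζ hn₀ hpos) (pow_ne_zero 2 (NeZero.ne b))

/-- `ζ = b^{d-2} ≥ 2` for `b ≥ 2`, `d ≥ 3`. -/
theorem two_le_zeta (hd : 3 ≤ d) (hb : 2 ≤ b) : 2 ≤ b ^ (d - 2) := by
  calc 2 ≤ b := hb
    _ = b ^ 1 := (pow_one b).symm
    _ ≤ b ^ (d - 2) := Nat.pow_le_pow_right (by omega) (by omega)

end Coefficients

/-! ### The interpolation: positivity and non-triviality survive `c ↦ α c` -/

section Interpolation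

variable {b : ℕ} [NeZero b]

omit [NeZero b] in
/-- The interpolated plaquette function is a convex combination: `f_{α c}(U) = (1 - α) + α f_c(U)`. -/
theorem plaqFn_scaleCoeff (J : ℕ) (c : ℕ → ℝ) (α : ℝ) (g : SU2) :
    plaqFn J (scaleCoeff α c) g = (1 - α) + α * plaqFn J c g := by
  unfold plaqFn scaleCoeff
  rw [mul_add, mul_one, Finset.mul_sum]
  have h : ∀ n ∈ Icc 1 J, ((n : ℝ) + 1) * (α * c n) * su2Char n g = α * (((n : ℝ) + 1) * c n * su2Char n g) :=
    fun n _ => by ring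
  rw [Finset.sum_congr rfl h]
  ring

omit [NeZero b] in
/-- **Positivity survives the interpolation**: `f_{α c} ≥ 0` for `α ∈ [0, 1]` when `f_c ≥ 0`. -/
theorem plaqFn_scaleCoeff_nonneg (J : ℕ) {c : ℕ → ℝ} (hf : ∀ g : SU2, 0 ≤ plaqFn J c g) {α : ℝ} (hα : α ∈ Set.Icc (0 : ℝ) 1)
    (g : SU2) : 0 ≤ plaqFn J (scaleCoeff α c) g := by
  rw [plaqFn_scaleCoeff]
  nlinarith [hf g, hα.1, hα.2]

/-- **Along the `r = 1` flow a positive coefficient stays positive**: `c_n > 0 ⇒ c^U_n(m) > 0` for every `m` (`b ≥ 1`). -/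
theorem iterCoeff_pos_of_pos (J : ℕ) {c : ℕ → ℝ} (hc : CoeffAdmissible c) (hf : ∀ g : SU2, 0 ≤ plaqFn J c g) {n₀ : ℕ}
    (hn₀ : n₀ ∈ Icc 1 J) (hpos : 0 < c n₀) (m : ℕ) : n₀ ∈ Icc 1 (iterJ b d J m) ∧ 0 < iterCoeff b d J c m n₀ := by
  have hζ : 1 ≤ b ^ (d - 2) := Nat.one_le_pow _ _ (Nat.pos_of_ne_zero (NeZero.ne b))
  induction m with
  | zero => exact ⟨hn₀, hpos⟩
  | succ m ih =>
    have hadm := (iterCoeff_admissible_nonneg (b := b) (d := d) J hc hf m).1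
    have hc' : ∀ n, 1 ≤ n → 0 ≤ iterCoeff b d J c m n := fun n hn => (hadm n hn).1
    refine ⟨?_, ?_⟩
    · have h := Finset.mem_Icc.1 ih.1
      exact Finset.mem_Icc.2 ⟨h.1, h.2.trans (by simp only [iterJ]; exact Nat.le_mul_of_pos_left _ hζ)⟩
    · simp only [iterCoeff]
      exact mkCoeff_pos_of_pos hc' hζ ih.1 ih.2 1

/-- **The next starting point is again in the class**: after choosing ANY `α ∈ (0, 1]` the interpolated decimated coefficients
`α · c^U(1,1)` are admissible, have a non-negative plaquette function and a positive coefficient in range (Tomboulis's successive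
scheme §3.3 run at `r = 1`). -/
theorem step_class_scaleCoeff_mkCoeff (J : ℕ) {c : ℕ → ℝ} (hc : CoeffAdmissible c) (hf : ∀ g : SU2, 0 ≤ plaqFn J c g) {n₀ : ℕ}
    (hn₀ : n₀ ∈ Icc 1 J) (hpos : 0 < c n₀) (ζ : ℕ) (hζ : 1 ≤ ζ) {α : ℝ} (hα : α ∈ Set.Ioc (0 : ℝ) 1) :
    CoeffAdmissible (scaleCoeff α (mkCoeff J c ζ b 1)) ∧
      (∀ g : SU2, 0 ≤ plaqFn (ζ * J) (scaleCoeff α (mkCoeff J c ζ b 1)) g) ∧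
      n₀ ∈ Icc 1 (ζ * J) ∧ 0 < scaleCoeff α (mkCoeff J c ζ b 1) n₀ := by
  have hc' : ∀ n, 1 ≤ n → 0 ≤ c n := fun n hn => (hc n hn).1
  have hα' : α ∈ Set.Icc (0 : ℝ) 1 := ⟨hα.1.le, hα.2⟩
  refine ⟨coeffAdmissible_scaleCoeff (coeffAdmissible_mkCoeff_one_of_nonneg hc' hf ζ b) hα', fun g =>
    plaqFn_scaleCoeff_nonneg _ (plaqFn_mkCoeff_one_nonneg hc' hf ζ b) hα' g, ?_, ?_⟩
  · have h := Finset.mem_Icc.1 hn₀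
    exact Finset.mem_Icc.2 ⟨h.1, h.2.trans (Nat.le_mul_of_pos_left J hζ)⟩
  · exact mul_pos hα.1 (mkCoeff_pos_of_pos hc' hζ hn₀ hpos 1)

end Interpolation

/-! ### Prop. III.3 / IV.5 STRICT on `(0, 1]` for `t > 0`: uniqueness of `α_Λ(t, r)` and `α⁺_Λ(t, r)` -/

section Unique

variable {b : ℕ} [NeZero b] [NeZero L]

omit [NeZero b] [NeZero L] in
/-- `h(·, t)` is STRICTLY increasing on `(0, ∞)` for `t > 0`. -/
theorem interpH_strictMonoOn {t : ℝ} (ht : 0 < t) : StrictMonoOn (fun a => interpH a t) (Set.Ioi 0) := by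
  intro α hα α' hα' h
  have hα0 : (0 : ℝ) < α := hα
  have hα'0 : (0 : ℝ) < α' := hα'
  simp only [interpH_eq t hα0.ne', interpH_eq t hα'0.ne']
  exact Real.exp_lt_exp.2 (sub_lt_sub_left (div_lt_div_of_pos_left ht hα0 h) t)

omit [NeZero b] in
/-- The coarse torus has at least one plaquette (`d ≥ 2`, `L ≥ 1`). -/
theorem card_plaquette_pos (hd : 2 ≤ d) : 0 < Fintype.card (Plaquette d L) := by
  refine Fintype.card_pos_iff.2 ⟨((fun _ => 0), ⟨(⟨0, by omega⟩, ⟨1, by omega⟩), Fin.mk_lt_mk.2 (by norm_num)⟩)⟩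

omit [NeZero b] in
/-- `Z_{Λ^{(1)}}({α c^U_j(1,r)})` is non-decreasing in `α ∈ (0, 1]` (II.1 (i) on the even coarse torus; the inner step of
`InterpolationAlpha.tildeZ_monotoneOn`). -/
theorem torusZ_scaleCoeff_mkCoeff_mono (hd : 3 ≤ d) (hL : Even L) (J : ℕ) {c : ℕ → ℝ} (hc : ∀ n, 1 ≤ n → 0 ≤ c n)
    (hf : ∀ g : SU2, 0 ≤ plaqFn J c g) {r : ℝ} (hr : 0 ≤ r) {α α' : ℝ} (hα : 0 < α) (hαα' : α ≤ α') (hα' : α' ≤ 1) :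
    torusZ d L (b ^ (d - 2) * J) (scaleCoeff α (mkCoeff J c (b ^ (d - 2)) b r)) ≤
      torusZ d L (b ^ (d - 2) * J) (scaleCoeff α' (mkCoeff J c (b ^ (d - 2)) b r)) := by
  haveI : NeZero d := ⟨by omega⟩
  haveI : Fact (1 < L) := ⟨by obtain ⟨k, hk⟩ := hL; have := NeZero.ne L; omega⟩
  have hadm := coeffAdmissible_mkCoeff_of_nonneg (b := b) J hc hf (b ^ (d - 2)) hr
  exact coeffMonotone hL _ _ _ (coeffAdmissible_scaleCoeff hadm ⟨hα.le, hαα'.trans hα'⟩)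
    (coeffAdmissible_scaleCoeff hadm ⟨hα.le.trans hαα', hα'⟩) fun n => by
      unfold scaleCoeff
      by_cases hn : 1 ≤ n
      · exact mul_le_mul_of_nonneg_right hαα' (hadm n hn).1
      · have h0 : n = 0 := by omega
        subst h0
        have : mkCoeff J c (b ^ (d - 2)) b r 0 = 1 := by
          rw [mkCoeff_eq_rpow]
          unfold hatCoeff
          rw [div_self (mkFhat_zero_pos hc _).ne', Real.one_rpow]
        rw [this, mul_one, mul_one]
        exact hαα'

/-- **Prop. III.3 STRICT (arXiv:0707.2179 (3.21)): `α ↦ Z̃(α, t)` is STRICTLY increasing on `(0, 1]`** for `t > 0`, `d ≥ 3`, `b ≥ 2`,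
even coarse torus, on the positivity domain with some `c_n > 0` — the bulk factor `F₀^U > 1` carries the strictly increasing
exponent `h(α, t) |Λ^{(1)}|`, and `Z_{Λ^{(1)}}({α c^U})` is non-decreasing and positive. -/
theorem tildeZ_strictMonoOn (hd : 3 ≤ d) (hb : 2 ≤ b) (hL : Even L) (J : ℕ) {c : ℕ → ℝ} (hc : ∀ n, 1 ≤ n → 0 ≤ c n)
    (hf : ∀ g : SU2, 0 ≤ plaqFn J c g) {n₀ : ℕ} (hn₀ : n₀ ∈ Icc 1 J) (hpos : 0 < c n₀) {r : ℝ} (hr : 0 ≤ r) {t : ℝ}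
    (ht : 0 < t) : StrictMonoOn (fun α => tildeZ d L b J r c α t) (Set.Ioc 0 1) := by
  intro α hα α' hα' hαα'
  have hF : 1 < mkF0 J c (b ^ (d - 2)) b := one_lt_mkF0 hc (two_le_zeta hd hb) hn₀ hpos
  have hN : (0 : ℝ) < (Fintype.card (Plaquette d L) : ℝ) := Nat.cast_pos.2 (card_plaquette_pos (by omega))
  have hadm := coeffAdmissible_mkCoeff_of_nonneg (b := b) J hc hf (b ^ (d - 2)) hr
  unfold tildeZ
  refine mul_lt_mul ?_ (torusZ_scaleCoeff_mkCoeff_mono hd hL J hc hf hr hα.1 hαα'.le hα'.2) ?_ (Real.rpow_nonneg (zero_le_one.trans hF.le) _)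
  · exact Real.rpow_lt_rpow_of_exponent_lt hF (mul_lt_mul_of_pos_right (interpH_strictMonoOn ht hα.1 hα'.1 hαα') hN)
  · exact zero_lt_one.trans_le (one_le_torusZ_even hd hL _ (coeffAdmissible_scaleCoeff hadm ⟨hα.1.le, hα.2⟩))

/-- **Uniqueness of `α_Λ(t, r)`** («This value is unique by III.3», arXiv:0707.2179 after (3.23)): two solutions of the defining
relation `IsAlpha d L b J r c t ·` coincide (`t > 0`, hypotheses as in `tildeZ_strictMonoOn`). -/
theorem isAlpha_unique (hd : 3 ≤ d) (hb : 2 ≤ b) (hL : Even L) (J : ℕ) {c : ℕ → ℝ} (hc : ∀ n, 1 ≤ n → 0 ≤ c n)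
    (hf : ∀ g : SU2, 0 ≤ plaqFn J c g) {n₀ : ℕ} (hn₀ : n₀ ∈ Icc 1 J) (hpos : 0 < c n₀) {r : ℝ} (hr : 0 ≤ r) {t : ℝ} (ht : 0 < t)
    {α₁ α₂ : ℝ} (h₁ : IsAlpha d L b J r c t α₁) (h₂ : IsAlpha d L b J r c t α₂) : α₁ = α₂ :=
  (tildeZ_strictMonoOn hd hb hL J hc hf hn₀ hpos hr ht).injOn ⟨h₁.1.1, h₁.1.2.le⟩ ⟨h₂.1.1, h₂.1.2.le⟩ (h₁.2.trans h₂.2.symm)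

omit [NeZero b] in
/-- `Z⁺_{Λ^{(1)}}({α c^U_j(1,r)}; 𝒱)` is non-decreasing in `α ∈ (0, 1]` (IV.2 (i) via `torusZplus_mono`; the inner step of
`InterpolationAlphaPlus.tildeZplus_monotoneOn`). -/
theorem torusZplus_scaleCoeff_mkCoeff_mono (hL : Even L) (J : ℕ) {i j : Fin d} (hij : i < j) {c : ℕ → ℝ}
    (hc : ∀ n, 1 ≤ n → 0 ≤ c n) (hf : ∀ g : SU2, 0 ≤ plaqFn J c g) {r : ℝ} (hr : 0 ≤ r) {α α' : ℝ} (hα : 0 < α)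
    (hαα' : α ≤ α') (hα' : α' ≤ 1) :
    torusZplus d L (b ^ (d - 2) * J) (scaleCoeff α (mkCoeff J c (b ^ (d - 2)) b r)) (vortexSheet L i j hij) ≤
      torusZplus d L (b ^ (d - 2) * J) (scaleCoeff α' (mkCoeff J c (b ^ (d - 2)) b r)) (vortexSheet L i j hij) := by
  have hadm := coeffAdmissible_mkCoeff_of_nonneg (b := b) J hc hf (b ^ (d - 2)) hr
  exact torusZplus_mono hL _ hij (coeffAdmissible_scaleCoeff hadm ⟨hα.le, hαα'.trans hα'⟩)
    (coeffAdmissible_scaleCoeff hadm ⟨hα.le.trans hαα', hα'⟩) fun n => by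
      unfold scaleCoeff
      by_cases hn : 1 ≤ n
      · exact mul_le_mul_of_nonneg_right hαα' (hadm n hn).1
      · have h0 : n = 0 := by omega
        subst h0
        have : mkCoeff J c (b ^ (d - 2)) b r 0 = 1 := by
          rw [mkCoeff_eq_rpow]
          unfold hatCoeff
          rw [div_self (mkFhat_zero_pos hc _).ne', Real.one_rpow]
        rw [this, mul_one, mul_one]
        exact hαα'

/-- **Prop. IV.5 STRICT (arXiv:0707.2179 (4.16)): `α ↦ Z̃⁺(α, t)` is STRICTLY increasing on `(0, 1]`** for `t > 0` (`d ≥ 3`, `b ≥ 2`,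
even coarse torus, every plane, positivity domain, some `c_n > 0`). -/
theorem tildeZplus_strictMonoOn (hd : 3 ≤ d) (hb : 2 ≤ b) (hL : Even L) (J : ℕ) {i j : Fin d} (hij : i < j) {c : ℕ → ℝ}
    (hc : ∀ n, 1 ≤ n → 0 ≤ c n) (hf : ∀ g : SU2, 0 ≤ plaqFn J c g) {n₀ : ℕ} (hn₀ : n₀ ∈ Icc 1 J) (hpos : 0 < c n₀) {r : ℝ}
    (hr : 0 ≤ r) {t : ℝ} (ht : 0 < t) : StrictMonoOn (fun α => tildeZplus L b J r i j hij c α t) (Set.Ioc 0 1) := by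
  intro α hα α' hα' hαα'
  have hF : 1 < mkF0 J c (b ^ (d - 2)) b := one_lt_mkF0 hc (two_le_zeta hd hb) hn₀ hpos
  have hN : (0 : ℝ) < (Fintype.card (Plaquette d L) : ℝ) := Nat.cast_pos.2 (card_plaquette_pos (by omega))
  have hadm := coeffAdmissible_mkCoeff_of_nonneg (b := b) J hc hf (b ^ (d - 2)) hr
  unfold tildeZplus
  refine mul_lt_mul ?_ (torusZplus_scaleCoeff_mkCoeff_mono hL J hij hc hf hr hα.1 hαα'.le hα'.2) ?_
    (Real.rpow_nonneg (zero_le_one.trans hF.le) _)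
  · exact Real.rpow_lt_rpow_of_exponent_lt hF (mul_lt_mul_of_pos_right (interpH_strictMonoOn ht hα.1 hα'.1 hαα') hN)
  · exact zero_lt_one.trans_le (one_le_torusZplus hd hL _ hij (coeffAdmissible_scaleCoeff hadm ⟨hα.1.le, hα.2⟩))

/-- **Uniqueness of `α⁺_Λ(t, r)`** (by IV.5): two solutions of `IsAlphaPlus L b J r i j hij c t ·` coincide (`t > 0`). -/
theorem isAlphaPlus_unique (hd : 3 ≤ d) (hb : 2 ≤ b) (hL : Even L) (J : ℕ) {i j : Fin d} (hij : i < j) {c : ℕ → ℝ}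
    (hc : ∀ n, 1 ≤ n → 0 ≤ c n) (hf : ∀ g : SU2, 0 ≤ plaqFn J c g) {n₀ : ℕ} (hn₀ : n₀ ∈ Icc 1 J) (hpos : 0 < c n₀) {r : ℝ}
    (hr : 0 ≤ r) {t : ℝ} (ht : 0 < t) {α₁ α₂ : ℝ} (h₁ : IsAlphaPlus L b J r i j hij c t α₁)
    (h₂ : IsAlphaPlus L b J r i j hij c t α₂) : α₁ = α₂ :=
  (tildeZplus_strictMonoOn hd hb hL J hij hc hf hn₀ hpos hr ht).injOn ⟨h₁.1.1, h₁.1.2.le⟩ ⟨h₂.1.1, h₂.1.2.le⟩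
    (h₁.2.trans h₂.2.symm)

end Unique

end Summit.Ventures.YMGap.Census

end
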